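import Summits.QuantumFields.BalabanUV.Beta.GAN24.CrossedLedgerClosure

/-!
# `BalabanUV.Beta.GAN24.CrossedLedgerCellLaw` — binder row G-an2-4 ∕ (CONV-C), W-slot (α-0), ROW (C)sym AT LEVELS `≥ 1`, register PART VI row **T6-VAL**
# (the crossed ledger `hX` ∕ `hXu` of the OWNER's two-index tower): **TWO OUT OF THREE — once the level-`0` Wilson number is met, the WHOLE residual content of the
# ledger is the CELL LAW `Xc (m+1) = γ·G (m+1) 0`** (the forcing's crossed cell value at level `m+1` is `γ`× the deeper term of its own level-`m` crossed face value at the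
# lowest period), and at the literal's pins that law reads `Xc (m+1) = 4·Lc⁴·P(m+1)·V (m+1) 1`
# (G-an2-4 CRUX TEAM (2), leaf prover 03 `b2b-balaban-gan24-formalise-leaf-03`, gen 73; journal [LEAF03-G73-INTENT1])

NOT IN PRINT; OUR BOOKKEEPING ([folklore] `linear_combination` ∕ `field_simp` over free real letters behind this lineage's `CrossedLedgerClosure` (✓ p382567) — its §0
`valLedger_all_iff_cumulative` (no hypothesis) and §1 `faceSum_eq_of_potential` (face potential only); 0 `def`, 0 cited fact, 0 `def … : Prop`, 0 sorry).
HONEST FRAMING (cell contract, verbatim): «discharging `BetaPertH` makes Bałaban's UV stability UNCONDITIONAL — a real constructive-QFT result; it is NOT the continuum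
limit and NOT the Clay problem.»  HONEST DEPENDENCY (verbatim): «continuum YM on T⁴ ⇐ BetaPertH ∧ nine spine estimates (0/9 proved); BetaPertH ⇐ (D1) ∧ (D4) ∧ CAP+tail;
G-an2-4 gates asym, D1 and NE2/3/4.»

WHY.  `CrossedLedgerClosure` §2 says: GRANTED all three potential shapes of the forcing's crossed values — `hface : Xf (k+1) m = G (k+1) (m+1) − G (k+2) m` (levels `≥ 1`),
`hface0 : Xf 0 m = W m − G 1 m` (level `0` = Wilson part minus the tower's first column) AND the cell law `hcell : Xc (i+1) = γ·G (i+1) 0` — the ledger `(∀ l, VAL-l)` is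
EQUIVALENT to the Wilson law `∀ m, γ·W m = Xc 0 − γ·(F0 (m+1) − F0 0)` (at the pins: `W m = −4·Lc⁸·(Lc²·(P m)² − 1)`).  leaf-06 g57's R-leaf06-g57-1 (journal l.59841;
`DepthTowerPrefactors.pin_levelZero_faceNumber` ✓ p384015 with `WilsonProfilePairing`) MEETS that Wilson number on the typed level-`0` values, and the OWNER's
`gen41/END-STATE-g41.md` §3′ locates what is left as adapter bookkeeping plus «`hκ` unexamined».  THIS FILE turns the closure round: the three statements {ledger, Wilson law,
cell law} are such that, granted the two FACE shapes alone, ANY TWO GIVE THE THIRD (§2) — so once the Wilson number is in the tree, `hX` ∕ `hXu` is EQUIVALENT to the cell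
law and to nothing else (§2 `valLedger_all_iff_cellLaw_of_wilsonLaw`, §4 at the pins), and conversely the ledger together with the Wilson number FORCES the cell law.  The cell
law is an INTERNAL consistency of the forcing's words between consecutive levels: `G (m+1) 0` is, by `hface` at `(k, m) = (m, 0)` (resp. `hface0` at `m = 0`), the DEEPER TERM of
the level-`m` crossed face value at the lowest face period — no Wilson-level number enters it.  In leaf-06's depth-tower letters (`G k n = c k·V k (n+1)`, §3) it reads
`Xc (m+1) = γ·c (m+1)·V (m+1) 1`; with g57's normalisation `c k = 8·P(k)` (`K7-ZERO-g57.md` §2–§3) and `γ = Lc⁴∕2` it is `Xc (m+1) = 4·Lc⁴·P(m+1)·V (m+1) 1` (§4) — g57's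
READING of `hκ` («`κ(i+1)·V = Lc^{d+1}·4·P(i+1)·V`», §3 ibid.) as the EXACT target the ledger imposes, in road-P2's currency: `X(zmode_Lc b̃_{m+1})(a,b) = 4·Lc⁴·P(m+1)·V^×(m+1, Lc)`.

WHAT ([folklore]; letters of `CrossedLedgerClosure`: `G Xf : ℕ → ℕ → ℝ`, `W Xc F0 : ℕ → ℝ`, `γ : ℝ`; §3 `V : ℕ → ℕ → ℝ`, `c R : ℕ → ℝ`, `ρ : ℝ`):
* §1 **`cumulative_eq_of_facePotential`** — with the two FACE shapes only: `D (m+1) = (Xc (m+1) − γ·G (m+1) 0) + γ·(W m + F0 (m+1))` (the cell DEFECT appears);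
  **`valLedger_all_iff_cellDefect`** — `(∀ l, VAL-l) ⟺ ∀ m, (Xc (m+1) − γ·G (m+1) 0) + γ·W m = Xc 0 − γ·(F0 (m+1) − F0 0)`.
* §2 TWO OUT OF THREE: **`valLedger_all_iff_cellLaw_of_wilsonLaw`** (Wilson law ⟹ (ledger ⟺ cell law)); **`cellLaw_iff_wilsonLaw_of_valLedger`** (ledger ⟹ (cell law ⟺
  Wilson law)); **`cellLaw_of_valLedger_of_wilsonLaw`**.  (Cell law ⟹ (ledger ⟺ Wilson law) is `CrossedLedgerClosure.valLedger_all_iff_of_potential`, not restated.)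
* §3 in leaf-06's letters: **`valLedger_all_iff_cell_of_remainderLaw`** — granted `hface` ∕ `hc` ∕ `hface0` ∕ `hc0` of `CrossedLedgerTelescope` (NOT `hcell` ∕ `hκ`) and the
  remainder law `∀ m, γ·(c 0·R m) = Xc 0 − γ·(F0 (m+1) − F0 0)`: `(∀ l, VAL-l) ⟺ ∀ m, Xc (m+1) = γ·(c (m+1)·V (m+1) 1)` — i.e. `hcell ∧ hκ` merged IS the residual.
* §4 at the literal's pins (`γ = Lc⁴∕2`, `Xc 0 = −2·Lc¹²·(Lc² − 1)`, `F0 m = 4·Lc⁸·(P m)²`, `P 0 = Lc`, `P (m+1) = Lc·P m`): **`valLedger_all_iff_cellLaw_of_targetNumber`** —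
  if the Wilson part IS the target number `W m = −4·Lc⁸·(Lc²·(P m)² − 1)`, then `(∀ l, VAL-l) ⟺ ∀ m, Xc (m+1) = Lc⁴∕2·G (m+1) 0`; **`valLedger_all_iff_cellTarget_pin`** —
  in leaf-06's letters with g57's `c k = 8·Pf k`: `⟺ ∀ m, Xc (m+1) = 4·Lc⁴·Pf (m+1)·V (m+1) 1`.
READING (weight 0 until the values are typed for the actual words): after R-leaf06-g57-1 the crossed conservation `hXu` is ONE inter-level identity per level — the forcing's
crossed CELL value at level `m+1` against the DEEPER term of its crossed FACE value at level `m`, period `Lc` — with the explicit prefactor `4·Lc⁴·Pf(m+1)`; the Wilson number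
is no longer part of it.  Asserts NO value and NO shape of Bałaban's tables (every shape and every number is a HYPOTHESIS over free letters); discharges NOTHING of `hX` ∕ `hXu` ∕
`hSrcX` ∕ (C)_{≥1} ∕ `hB0` ∕ `hBF` ∕ (Q-L) ∕ (hW, hWall); NEVER «G-an2-4 closed» as (CONV-C); NOT D1, NOT `BetaPertH`, NOT continuum, NOT Clay.  2026-08-24; no existing file touched.
-/

open Finset
open scoped BigOperators

namespace Summit.QuantumFields.BalabanUV.Beta.GAN24.CrossedLedgerCellLaw

open Summit.QuantumFields.BalabanUV.Beta.GAN24.CrossedLedgerClosure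
  (valLedger_all_iff_cumulative faceSum_eq_of_potential potential_of_depthTower_face potential_of_depthTower_face0 wilson_target_iff_pin)

variable {G Xf : ℕ → ℕ → ℝ} {W Xc F0 : ℕ → ℝ} {γ : ℝ}

/-! ## §1 The cumulative quantity with the two FACE shapes only: the cell defect -/

/-- NOT IN PRINT; OUR BOOKKEEPING.  **THE CUMULATIVE QUANTITY, FACE SHAPES ONLY**: with `hface` (levels `≥ 1`) and `hface0` (level `0`) but NO cell hypothesis,
`Xc (m+1) + γ·(Σ_{k<m+1} Xf k (m−k) + F0 (m+1)) = (Xc (m+1) − γ·G (m+1) 0) + γ·(W m + F0 (m+1))` — the anti-diagonal telescopes to its two ends, and what is left of the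
tower is the CELL DEFECT `Xc (m+1) − γ·G (m+1) 0`. -/
theorem cumulative_eq_of_facePotential (hface : ∀ k m, Xf (k + 1) m = G (k + 1) (m + 1) - G (k + 2) m)
    (hface0 : ∀ m, Xf 0 m = W m - G 1 m) (m : ℕ) :
    Xc (m + 1) + γ * ((∑ k ∈ range (m + 1), Xf k (m - k)) + F0 (m + 1))
      = (Xc (m + 1) - γ * G (m + 1) 0) + γ * (W m + F0 (m + 1)) := by
  rw [faceSum_eq_of_potential hface m, hface0 m]
  ring

/-- NOT IN PRINT; OUR BOOKKEEPING.  **THE WHOLE LEDGER WITH THE CELL DEFECT DISPLAYED** (face shapes only; `γ` arbitrary): `(∀ l, VAL-l) ⟺ ∀ m,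
(Xc (m+1) − γ·G (m+1) 0) + γ·W m = Xc 0 − γ·(F0 (m+1) − F0 0)`.  With the cell law the defect vanishes and this is `CrossedLedgerClosure.valLedger_all_iff_of_potential`. -/
theorem valLedger_all_iff_cellDefect (hface : ∀ k m, Xf (k + 1) m = G (k + 1) (m + 1) - G (k + 2) m)
    (hface0 : ∀ m, Xf 0 m = W m - G 1 m) :
    (∀ l : ℕ, (Xc (l + 1) - Xc l)
        + γ * (((∑ k ∈ range (l + 1), Xf k (l - k)) - ∑ k ∈ range l, Xf k (l - 1 - k)) + (F0 (l + 1) - F0 l)) = 0) ↔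
      ∀ m : ℕ, (Xc (m + 1) - γ * G (m + 1) 0) + γ * W m = Xc 0 - γ * (F0 (m + 1) - F0 0) := by
  refine (valLedger_all_iff_cumulative (Xc := Xc) (Xf := Xf) (F0 := F0) (γ := γ)).trans (forall_congr' fun m => ?_)
  rw [cumulative_eq_of_facePotential (F0 := F0) hface hface0 m]
  constructor
  · intro h
    linear_combination h
  · intro h
    linear_combination h

/-! ## §2 Two out of three -/

/-- NOT IN PRINT; OUR BOOKKEEPING.  **WILSON LAW ⟹ (LEDGER ⟺ CELL LAW)** (face shapes only): if the level-`0` Wilson part obeys `∀ m, γ·W m = Xc 0 − γ·(F0 (m+1) − F0 0)`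
— the formula of `CrossedLedgerClosure.valLedger_all_iff_of_potential`, MET on the numbers by leaf-06 g57's R-leaf06-g57-1 — then the family of ledger lines (VAL-l) holds
IF AND ONLY IF the cell law `∀ m, Xc (m+1) = γ·G (m+1) 0` holds: the forcing's crossed cell value at level `m+1` is `γ`× the deeper term of its level-`m` crossed face value
at the lowest face period.  THE WHOLE RESIDUAL CONTENT OF `hX` AFTER THE WILSON NUMBER. -/
theorem valLedger_all_iff_cellLaw_of_wilsonLaw (hface : ∀ k m, Xf (k + 1) m = G (k + 1) (m + 1) - G (k + 2) m)
    (hface0 : ∀ m, Xf 0 m = W m - G 1 m) (hW : ∀ m, γ * W m = Xc 0 - γ * (F0 (m + 1) - F0 0)) :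
    (∀ l : ℕ, (Xc (l + 1) - Xc l)
        + γ * (((∑ k ∈ range (l + 1), Xf k (l - k)) - ∑ k ∈ range l, Xf k (l - 1 - k)) + (F0 (l + 1) - F0 l)) = 0) ↔
      ∀ m : ℕ, Xc (m + 1) = γ * G (m + 1) 0 := by
  refine (valLedger_all_iff_cellDefect (F0 := F0) hface hface0).trans (forall_congr' fun m => ?_)
  constructor
  · intro h
    linear_combination h - hW m
  · intro h
    linear_combination h + hW m

/-- NOT IN PRINT; OUR BOOKKEEPING.  **LEDGER ⟹ (CELL LAW ⟺ WILSON LAW)** (face shapes only): if the ledger lines (VAL-l) all hold, the cell law at every level and the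
Wilson law at every period index are EQUIVALENT — the third side of the triangle (`CrossedLedgerClosure.valLedger_all_iff_of_potential` is «cell law ⟹ (ledger ⟺ Wilson law)»,
`valLedger_all_iff_cellLaw_of_wilsonLaw` is «Wilson law ⟹ (ledger ⟺ cell law)»). -/
theorem cellLaw_iff_wilsonLaw_of_valLedger (hface : ∀ k m, Xf (k + 1) m = G (k + 1) (m + 1) - G (k + 2) m)
    (hface0 : ∀ m, Xf 0 m = W m - G 1 m)
    (hX : ∀ l : ℕ, (Xc (l + 1) - Xc l)
        + γ * (((∑ k ∈ range (l + 1), Xf k (l - k)) - ∑ k ∈ range l, Xf k (l - 1 - k)) + (F0 (l + 1) - F0 l)) = 0) :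
    (∀ m : ℕ, Xc (m + 1) = γ * G (m + 1) 0) ↔ ∀ m : ℕ, γ * W m = Xc 0 - γ * (F0 (m + 1) - F0 0) := by
  have hD := (valLedger_all_iff_cellDefect (F0 := F0) hface hface0).1 hX
  refine forall_congr' fun m => ?_
  constructor
  · intro h
    linear_combination hD m - h
  · intro h
    linear_combination hD m - h

/-- NOT IN PRINT; OUR BOOKKEEPING.  **LEDGER ∧ WILSON LAW ⟹ CELL LAW, level by level** (face shapes only). -/
theorem cellLaw_of_valLedger_of_wilsonLaw (hface : ∀ k m, Xf (k + 1) m = G (k + 1) (m + 1) - G (k + 2) m)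
    (hface0 : ∀ m, Xf 0 m = W m - G 1 m)
    (hX : ∀ l : ℕ, (Xc (l + 1) - Xc l)
        + γ * (((∑ k ∈ range (l + 1), Xf k (l - k)) - ∑ k ∈ range l, Xf k (l - 1 - k)) + (F0 (l + 1) - F0 l)) = 0)
    (hW : ∀ m, γ * W m = Xc 0 - γ * (F0 (m + 1) - F0 0)) (m : ℕ) :
    Xc (m + 1) = γ * G (m + 1) 0 :=
  (valLedger_all_iff_cellLaw_of_wilsonLaw (F0 := F0) hface hface0 hW).1 hX m

/-! ## §3 In leaf-06's depth-tower letters: `hcell ∧ hκ` IS the residual -/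

section DepthTower

variable {V : ℕ → ℕ → ℝ} {c R : ℕ → ℝ} {ρ : ℝ}

/-- NOT IN PRINT; OUR BOOKKEEPING.  **THE RESIDUAL IN g55's LETTERS**: granted the FACE shapes `hface` ∕ `hc` (K7-a ∕ K7-b's level law) and `hface0` ∕ `hc0` (K7-0) of
`CrossedLedgerTelescope` — but NOT the cell shapes `hcell` ∕ `hκ` — and the remainder law `∀ m, γ·(c 0·R m) = Xc 0 − γ·(F0 (m+1) − F0 0)` (the right side of
`CrossedLedgerClosure.valLedger_all_iff_remainder`), the ledger holds IF AND ONLY IF `∀ m, Xc (m+1) = γ·(c (m+1)·V (m+1) 1)`: the merged `hcell ∧ hκ` — the level-`(m+1)`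
crossed cell value is `γ·c (m+1)`× the lowest-period pairing `V (m+1) 1` — is EXACTLY what remains. -/
theorem valLedger_all_iff_cell_of_remainderLaw
    (hface : ∀ k m, Xf (k + 1) m = c (k + 1) * (V (k + 1) (m + 2) - ρ * V (k + 2) (m + 1)))
    (hc : ∀ k, c (k + 2) = ρ * c (k + 1))
    (hface0 : ∀ m, Xf 0 m = c 0 * (R m - ρ * V 1 (m + 1))) (hc0 : c 1 = ρ * c 0)
    (hR : ∀ m, γ * (c 0 * R m) = Xc 0 - γ * (F0 (m + 1) - F0 0)) :
    (∀ l : ℕ, (Xc (l + 1) - Xc l)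
        + γ * (((∑ k ∈ range (l + 1), Xf k (l - k)) - ∑ k ∈ range l, Xf k (l - 1 - k)) + (F0 (l + 1) - F0 l)) = 0) ↔
      ∀ m : ℕ, Xc (m + 1) = γ * (c (m + 1) * V (m + 1) 1) := by
  have h := valLedger_all_iff_cellLaw_of_wilsonLaw (Xc := Xc) (G := fun k n => c k * V k (n + 1)) (W := fun m => c 0 * R m) (F0 := F0)
    (potential_of_depthTower_face hface hc) (potential_of_depthTower_face0 hface0 hc0) hR
  simpa only [Nat.zero_add] using h

end DepthTower

/-! ## §4 At the literal's pins: the cell target -/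

/-- NOT IN PRINT; OUR BOOKKEEPING.  **AT THE PINS: IF THE WILSON PART IS THE TARGET NUMBER, THE LEDGER IS THE CELL LAW** (potential form, face shapes only; pins
`γ = Lc⁴∕2`, `Xc 0 = −2·Lc¹²·(Lc² − 1)` (leaf-06 g55 `crossed_zmode_forcing_level0_pin`), `F0 m = 4·Lc⁸·(P m)²` (the OWNER's base at `c = (8M²)⁻¹`), `P 0 = Lc`,
`P (m+1) = Lc·P m`): `∀ m, W m = −4·Lc⁸·(Lc²·(P m)² − 1)` — `CrossedLedgerClosure.valLedger_all_iff_target_pin`'s right side, MET by leaf-06 g57's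
`DepthTowerPrefactors.pin_levelZero_faceNumber` on the typed level-`0` values — implies `(∀ l, VAL-l) ⟺ ∀ m, Xc (m+1) = Lc⁴∕2·G (m+1) 0`. -/
theorem valLedger_all_iff_cellLaw_of_targetNumber (hface : ∀ k m, Xf (k + 1) m = G (k + 1) (m + 1) - G (k + 2) m)
    (hface0 : ∀ m, Xf 0 m = W m - G 1 m)
    {Lc : ℝ} (hLc : Lc ≠ 0) {P : ℕ → ℝ} (hP0 : P 0 = Lc) (hPs : ∀ m, P (m + 1) = Lc * P m)
    (hγ : γ = Lc ^ 4 / 2) (hXc0 : Xc 0 = -2 * Lc ^ 12 * (Lc ^ 2 - 1)) (hF0 : ∀ m, F0 m = 4 * Lc ^ 8 * (P m) ^ 2)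
    (hWn : ∀ m : ℕ, W m = -4 * Lc ^ 8 * (Lc ^ 2 * (P m) ^ 2 - 1)) :
    (∀ l : ℕ, (Xc (l + 1) - Xc l)
        + γ * (((∑ k ∈ range (l + 1), Xf k (l - k)) - ∑ k ∈ range l, Xf k (l - 1 - k)) + (F0 (l + 1) - F0 l)) = 0) ↔
      ∀ m : ℕ, Xc (m + 1) = Lc ^ 4 / 2 * G (m + 1) 0 := by
  have hW : ∀ m, γ * W m = Xc 0 - γ * (F0 (m + 1) - F0 0) := (wilson_target_iff_pin (W := W) hLc hP0 hPs hγ hXc0 hF0).2 hWn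
  rw [← hγ]
  exact valLedger_all_iff_cellLaw_of_wilsonLaw (F0 := F0) hface hface0 hW

/-- NOT IN PRINT; OUR BOOKKEEPING.  **THE CELL TARGET AT THE PINS IN leaf-06's LETTERS**: granted the face shapes `hface` ∕ `hc` ∕ `hface0` ∕ `hc0`, g57's normalisation
`c k = 8·Pf k` of the composite E⊗E prefactor (`K7-ZERO-g57.md` §2: `Pf (k+1) = Lc^{2(d+1)}·Pf k`, not used here), the pins as in `valLedger_all_iff_cellLaw_of_targetNumber`,
and the Wilson number MET in the form `∀ m, c 0·R m = −4·Lc⁸·(Lc²·(P m)² − 1)` (R-leaf06-g57-1: `8·Pf(0)·V^×(0, Lc·P m)`): the ledger holds IF AND ONLY IF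
`∀ m, Xc (m+1) = 4·Lc⁴·Pf (m+1)·V (m+1) 1` — in road-P2's currency `X(zmode_Lc b̃_{m+1})(a,b) = 4·Lc⁴·P(m+1)·V^×(m+1, Lc)`, g57's READING of `hκ` as the exact target. -/
theorem valLedger_all_iff_cellTarget_pin {V : ℕ → ℕ → ℝ} {c R Pf : ℕ → ℝ} {ρ : ℝ}
    (hface : ∀ k m, Xf (k + 1) m = c (k + 1) * (V (k + 1) (m + 2) - ρ * V (k + 2) (m + 1)))
    (hc : ∀ k, c (k + 2) = ρ * c (k + 1))
    (hface0 : ∀ m, Xf 0 m = c 0 * (R m - ρ * V 1 (m + 1))) (hc0 : c 1 = ρ * c 0)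
    (hc8 : ∀ k, c k = 8 * Pf k)
    {Lc : ℝ} (hLc : Lc ≠ 0) {P : ℕ → ℝ} (hP0 : P 0 = Lc) (hPs : ∀ m, P (m + 1) = Lc * P m)
    (hγ : γ = Lc ^ 4 / 2) (hXc0 : Xc 0 = -2 * Lc ^ 12 * (Lc ^ 2 - 1)) (hF0 : ∀ m, F0 m = 4 * Lc ^ 8 * (P m) ^ 2)
    (hRn : ∀ m : ℕ, c 0 * R m = -4 * Lc ^ 8 * (Lc ^ 2 * (P m) ^ 2 - 1)) :
    (∀ l : ℕ, (Xc (l + 1) - Xc l)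
        + γ * (((∑ k ∈ range (l + 1), Xf k (l - k)) - ∑ k ∈ range l, Xf k (l - 1 - k)) + (F0 (l + 1) - F0 l)) = 0) ↔
      ∀ m : ℕ, Xc (m + 1) = 4 * Lc ^ 4 * Pf (m + 1) * V (m + 1) 1 := by
  have hR : ∀ m, γ * (c 0 * R m) = Xc 0 - γ * (F0 (m + 1) - F0 0) :=
    (wilson_target_iff_pin (W := fun m => c 0 * R m) hLc hP0 hPs hγ hXc0 hF0).2 hRn
  refine (valLedger_all_iff_cell_of_remainderLaw (F0 := F0) hface hc hface0 hc0 hR).trans (forall_congr' fun m => ?_)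
  rw [hγ, hc8 (m + 1)]
  constructor
  · intro h
    rw [h]
    ring
  · intro h
    rw [h]
    ring

end Summit.QuantumFields.BalabanUV.Beta.GAN24.CrossedLedgerCellLaw
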